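import Literature.AnabelianGeometry.EtaleTheta.SettingModel2CoveringsSemidirect
import HarnessLib

/-!
# The coverings `Π^tp_{Y_N} = Δ^tp_{Y_N} ⋊ B_N` in a twisted product `Γ ⋊_φ G` — WEAK twist data (degree-zero
# level shadow only), for the stage-2 «Tate shear» action

Mochizuki, *The étale theta function …*, Publ. RIMS **45** (2009) [EtTh], §1, PRIMS PDF pp. 12–14
[cite: MochizukiEtTh2009, §1 p.13]: "`Π^tp_{Y_N}`", "`Δ^tp_Y/Δ^tp_{Y_N} ≅ ℤ/Nℤ(1)`", "`Gal(Z_N/Y_N) ≅ ℤ/Nℤ(1)`".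
Layer L2 of the abc-iut cell (seat abc-iut-L6-d6 gen 4, R78 integration owner; R78-MAP #5 stage-2 item «GfpTwistData′»).
abc-iut-L2-t1's `SettingModel2CoveringsSemidirect.lean` derives the covering clauses of the root `ThetaSetting` in a
twisted product `Γ ⋊_φ G` from a `GfpTwistData φ`, whose field `hlev` asks that EVERY `φ_g` descend to each finite
Heisenberg level `Γ → Heis(ℤ/N)`. The stage-2 affine action `a ↦ a·b^k·c^m`, `b ↦ b^u` (abc-iut-L2-t6's `affTwist₃`,
abc-iut-L2-t5's `cocyclePairHom`) does NOT descend for `k ∉ N·Ẑ`, `N` even (`a² ∈ Ker ĥ₂` but `(ab)² ↦ (0,0,1)`),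
so `hlev` is unsatisfiable there. This file is the WEAK variant that both stages satisfy:

* `GfpTwistData₀ φ` — `hdeg` + a level shadow `δ` required only on the DEGREE-ZERO part `Ker(Γ ↠ ℤ)`
  (`hlev₀`; abc-iut-L2-t6's `hHat_gfpFst_affTwist₃Gfp_of_gfpSnd_eq_one` at stage 2, `hHat_gfpFst_twistGfp` at
  stage 1), and `GfpTwistData.toWeak` (every strong datum is a weak one);
* the same API as abc-iut-L2-t1's: `toZ`, `YN`, `ZN`, `YN_one_top`, `YN_le`, `ZN_le_YN`, anti-tonicity, images under
  `Γ ⋊ G ↠ G`, openness, `⊓ Ker`, indices `N`, `mem_ZN_of_levelHom_eq_one`;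
* NORMALITY `YN_normal₀` / `ZN_normal₀` under the hypothesis that `B ⊴ G` acts LEVEL-`N`-TRIVIALLY on all of `Γ`
  (`hB : ∀ b ∈ B, ∀ γ, levelHom N (φ b γ) = levelHom N γ` — abc-iut-L2-t6's `hHat_affTwist₃_of_level` on the
  congruence subgroup `{χ_N = 1, κ_p ≡ 0 (N)} ⊇ G_{K_N}` of abc-iut-L2-t5).

Model plumbing (pure group theory over `Γ = F̂₂ ×_Ẑ ℤ`); nothing of [EtTh] asserted; no side taken on [IUTchIII]
Cor. 3.12.
-/

noncomputable section

namespace Literature.AnabelianGeometry.EtaleTheta.SettingModel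

open Function

/-! ### Degree-zero stability lemmas -/

/-- `Δ^tp_{Y_N}` is stable under a degree-preserving `θ` whose level shadow `δ` ON DEGREE ZERO preserves the `z`-axis.
[cite: MochizukiEtTh2009, §1 p.13] -/
theorem map_mem_dY₀ {N : ℕ+} (θ : Gfp →* Gfp) (hdeg : ∀ γ, gfpSnd (θ γ) = gfpSnd γ)
    (δ : Heis (ZMod N) → Heis (ZMod N)) (hδ : ∀ ⦃h⦄, h ∈ (Heis.zAxis : Subgroup (Heis (ZMod N))) → δ h ∈ Heis.zAxis)
    (hlev₀ : ∀ γ, gfpSnd γ = 1 → levelHom N (θ γ) = δ (levelHom N γ)) {γ : Gfp} (hγ : γ ∈ dY N) : θ γ ∈ dY N := by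
  obtain ⟨h1, h2⟩ := Subgroup.mem_inf.mp hγ
  rw [MonoidHom.mem_ker] at h1
  refine Subgroup.mem_inf.mpr ⟨?_, Subgroup.mem_comap.mpr ?_⟩
  · rw [MonoidHom.mem_ker, hdeg, h1]
  · rw [hlev₀ γ h1]
    exact hδ (Subgroup.mem_comap.mp h2)

/-- `Δ^tp_{Z_N}` is stable under such a `θ` when `δ 1 = 1`. [cite: MochizukiEtTh2009, §1 p.14] -/
theorem map_mem_dZ₀ {N : ℕ+} (θ : Gfp →* Gfp) (hdeg : ∀ γ, gfpSnd (θ γ) = gfpSnd γ)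
    (δ : Heis (ZMod N) → Heis (ZMod N)) (hδ1 : δ 1 = 1)
    (hlev₀ : ∀ γ, gfpSnd γ = 1 → levelHom N (θ γ) = δ (levelHom N γ)) {γ : Gfp} (hγ : γ ∈ dZ N) : θ γ ∈ dZ N := by
  obtain ⟨h1, h2⟩ := Subgroup.mem_inf.mp hγ
  rw [MonoidHom.mem_ker] at h1 h2
  refine Subgroup.mem_inf.mpr ⟨?_, ?_⟩
  · rw [MonoidHom.mem_ker, hdeg, h1]
  · rw [MonoidHom.mem_ker, hlev₀ γ h1, h2, hδ1]

variable {G : Type*} [Group G]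

/-- **Weak twist data** for an action `φ : G → Aut Γ`: the degree is preserved and, on the DEGREE-ZERO part
`Ker(Γ ↠ ℤ)` only, each `φ_g` is read on the level `Γ → Heis(ℤ/N)` through a `z`-axis-preserving map `δ_{N,g}`.
[cite: MochizukiEtTh2009, §1 p.13] -/
structure GfpTwistData₀ (φ : G →* MulAut Gfp) where
  /-- `pr₂ ∘ φ_g = pr₂`. -/
  hdeg : ∀ (g : G) (γ : Gfp), gfpSnd (φ g γ) = gfpSnd γ
  /-- The level-`N` shadow of `φ g` on degree zero. -/
  δ : ∀ (N : ℕ+), G → Heis (ZMod N) → Heis (ZMod N)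
  /-- `δ` preserves the `z`-axis `{x = y = 0}`. -/
  δ_zAxis : ∀ (N : ℕ+) (g : G) ⦃h : Heis (ZMod N)⦄, h ∈ (Heis.zAxis : Subgroup (Heis (ZMod N))) →
    δ N g h ∈ (Heis.zAxis : Subgroup (Heis (ZMod N)))
  /-- `δ 1 = 1`. -/
  δ_one : ∀ (N : ℕ+) (g : G), δ N g 1 = 1
  /-- `ĥ_N ∘ φ_g = δ_{N,g} ∘ ĥ_N` ON DEGREE ZERO. -/
  hlev₀ : ∀ (N : ℕ+) (g : G) (γ : Gfp), gfpSnd γ = 1 → levelHom N (φ g γ) = δ N g (levelHom N γ)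

/-- Every (strong) twist datum is a weak one. [cite: MochizukiEtTh2009, §1 p.13] -/
def GfpTwistData.toWeak {φ : G →* MulAut Gfp} (T : GfpTwistData φ) : GfpTwistData₀ φ where
  hdeg := T.hdeg
  δ := T.δ
  δ_zAxis := T.δ_zAxis
  δ_one := T.δ_one
  hlev₀ N g γ _ := T.hlev N g γ

namespace GfpTwistData₀

variable {φ : G →* MulAut Gfp}

/-- `Δ^tp_{Y_N}` is `φ(G)`-stable. [cite: MochizukiEtTh2009, §1 p.13] -/
theorem act_mem_dY (T : GfpTwistData₀ φ) (N : ℕ+) (g : G) ⦃γ : Gfp⦄ (hγ : γ ∈ dY N) : φ g γ ∈ dY N :=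
  map_mem_dY₀ (φ g).toMonoidHom (T.hdeg g) (T.δ N g) (T.δ_zAxis N g) (T.hlev₀ N g) hγ

/-- `Δ^tp_{Z_N}` is `φ(G)`-stable. [cite: MochizukiEtTh2009, §1 p.14] -/
theorem act_mem_dZ (T : GfpTwistData₀ φ) (N : ℕ+) (g : G) ⦃γ : Gfp⦄ (hγ : γ ∈ dZ N) : φ g γ ∈ dZ N :=
  map_mem_dZ₀ (φ g).toMonoidHom (T.hdeg g) (T.δ N g) (T.δ_one N g) (T.hlev₀ N g) hγ

/-- `Π^tp_X ↠ Z` on `Γ ⋊_φ G`: `g ↦ pr₂(g.left)`. [cite: MochizukiEtTh2009, §1 p.12] -/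
def toZ (T : GfpTwistData₀ φ) : Gfp ⋊[φ] G →* Multiplicative ℤ := Semidirect.leftHom gfpSnd T.hdeg

/-- [cite: MochizukiEtTh2009, §1 p.12] -/
theorem toZ_apply (T : GfpTwistData₀ φ) (g : Gfp ⋊[φ] G) : T.toZ g = gfpSnd g.left := rfl

/-- [cite: MochizukiEtTh2009, §1 p.12] -/
theorem ker_toZ (T : GfpTwistData₀ φ) :
    T.toZ.ker = Semidirect.twistedProd gfpSnd.ker ⊤ (Semidirect.stable_ker gfpSnd T.hdeg ⊤) :=
  Semidirect.ker_leftHom gfpSnd T.hdeg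

/-- [cite: MochizukiEtTh2009, §1 p.12] -/
theorem toZ_surjective (T : GfpTwistData₀ φ) : Surjective T.toZ :=
  Semidirect.leftHom_surjective gfpSnd T.hdeg gfpSnd_surjective

/-- `Δ^tp_X ↠ Z` is onto. [cite: MochizukiEtTh2009, §1 p.12] -/
theorem toZ_restrict_surjective (T : GfpTwistData₀ φ) :
    Surjective (T.toZ.restrict (SemidirectProduct.rightHom : Gfp ⋊[φ] G →* G).ker) :=
  Semidirect.leftHom_restrict_ker_rightHom_surjective gfpSnd T.hdeg gfpSnd_surjective

/-- `Ker(Π^tp_X ↠ Z)` is open. [cite: MochizukiEtTh2009, §1 p.12] -/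
theorem isOpen_ker_toZ (T : GfpTwistData₀ φ) [TopologicalSpace G] [TopologicalSpace (Gfp ⋊[φ] G)]
    (hc : Continuous fun g : Gfp ⋊[φ] G => (g.left, g.right)) : IsOpen (T.toZ.ker : Set (Gfp ⋊[φ] G)) := by
  rw [ker_toZ]
  exact Semidirect.isOpen_twistedProd hc isOpen_ker_gfpSnd isOpen_univ

/-- `Π^tp_{Y_N} := Δ^tp_{Y_N} ⋊ B`. [cite: MochizukiEtTh2009, §1 p.13] -/
def YN (T : GfpTwistData₀ φ) (N : ℕ+) (B : Subgroup G) : Subgroup (Gfp ⋊[φ] G) :=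
  Semidirect.twistedProd (dY N) B (Semidirect.stable_of_forall (T.act_mem_dY N) B)

/-- `Π^tp_{Z_N} := Δ^tp_{Z_N} ⋊ B`. [cite: MochizukiEtTh2009, §1 p.14] -/
def ZN (T : GfpTwistData₀ φ) (N : ℕ+) (B : Subgroup G) : Subgroup (Gfp ⋊[φ] G) :=
  Semidirect.twistedProd (dZ N) B (Semidirect.stable_of_forall (T.act_mem_dZ N) B)

/-- [cite: MochizukiEtTh2009, §1 p.13] -/
theorem mem_YN (T : GfpTwistData₀ φ) {N : ℕ+} {B : Subgroup G} {g : Gfp ⋊[φ] G} :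
    g ∈ T.YN N B ↔ g.left ∈ dY N ∧ g.right ∈ B := Iff.rfl

/-- [cite: MochizukiEtTh2009, §1 p.14] -/
theorem mem_ZN (T : GfpTwistData₀ φ) {N : ℕ+} {B : Subgroup G} {g : Gfp ⋊[φ] G} :
    g ∈ T.ZN N B ↔ g.left ∈ dZ N ∧ g.right ∈ B := Iff.rfl

/-- `Π^tp_{Y_1} = Π^tp_Y` (for `B = ⊤`). [cite: MochizukiEtTh2009, §1 p.14] -/
theorem YN_one_top (T : GfpTwistData₀ φ) : T.YN 1 ⊤ = T.toZ.ker := by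
  rw [ker_toZ]
  exact Semidirect.twistedProd_eq_of_eq dY_one rfl

/-- `Π^tp_{Y_N} ≤ Π^tp_Y`. [cite: MochizukiEtTh2009, §1 p.13] -/
theorem YN_le (T : GfpTwistData₀ φ) (N : ℕ+) (B : Subgroup G) : T.YN N B ≤ T.toZ.ker := by
  rw [ker_toZ]
  exact Semidirect.twistedProd_mono (dY_le N) le_top

/-- `Π^tp_{Z_N} ≤ Π^tp_{Y_N}` (for `B' ≤ B`). [cite: MochizukiEtTh2009, §1 p.14] -/
theorem ZN_le_YN (T : GfpTwistData₀ φ) (N : ℕ+) {B' B : Subgroup G} (h : B' ≤ B) : T.ZN N B' ≤ T.YN N B :=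
  Semidirect.twistedProd_mono (dZ_le_dY N) h

/-- [cite: MochizukiEtTh2009, §1 p.18] -/
theorem YN_anti (T : GfpTwistData₀ φ) {M N : ℕ+} (h : (M : ℕ) ∣ N) {B_N B_M : Subgroup G} (hB : B_N ≤ B_M) :
    T.YN N B_N ≤ T.YN M B_M :=
  Semidirect.twistedProd_mono (dY_anti h) hB

/-- [cite: MochizukiEtTh2009, §1 p.18] -/
theorem ZN_anti (T : GfpTwistData₀ φ) {M N : ℕ+} (h : (M : ℕ) ∣ N) {B_N B_M : Subgroup G} (hB : B_N ≤ B_M) :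
    T.ZN N B_N ≤ T.ZN M B_M :=
  Semidirect.twistedProd_mono (dZ_anti h) hB

/-- `Π^tp_{Y_N} ↠ B`. [cite: MochizukiEtTh2009, §1 p.13] -/
theorem map_rightHom_YN (T : GfpTwistData₀ φ) (N : ℕ+) (B : Subgroup G) :
    (T.YN N B).map (SemidirectProduct.rightHom : Gfp ⋊[φ] G →* G) = B :=
  Semidirect.map_rightHom_twistedProd

/-- `Π^tp_{Z_N} ↠ B`. [cite: MochizukiEtTh2009, §1 p.14] -/
theorem map_rightHom_ZN (T : GfpTwistData₀ φ) (N : ℕ+) (B : Subgroup G) :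
    (T.ZN N B).map (SemidirectProduct.rightHom : Gfp ⋊[φ] G →* G) = B :=
  Semidirect.map_rightHom_twistedProd

/-- **`Π^tp_{Y_N}` is normal** when `B ⊴ G` acts LEVEL-`N`-TRIVIALLY on all of `Γ` (`χ_N ≡ 1`, `κ ≡ 0 (N)` on
`G_{K_N}`). [cite: MochizukiEtTh2009, §1 p.14] -/
theorem YN_normal₀ (T : GfpTwistData₀ φ) (N : ℕ+) (B : Subgroup G) [B.Normal]
    (hB : ∀ ⦃b⦄, b ∈ B → ∀ γ : Gfp, levelHom N (φ b γ) = levelHom N γ) : (T.YN N B).Normal := by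
  haveI := dY_normal N
  refine Semidirect.twistedProd_normal (T.act_mem_dY N) ?_
  intro b hb γ
  exact mul_inv_map_mem_dY (φ b).toMonoidHom (T.hdeg b) (hB hb) γ

/-- **`Π^tp_{Z_N}` is normal** under the same condition on `B`. [cite: MochizukiEtTh2009, §1 p.14] -/
theorem ZN_normal₀ (T : GfpTwistData₀ φ) (N : ℕ+) (B : Subgroup G) [B.Normal]
    (hB : ∀ ⦃b⦄, b ∈ B → ∀ γ : Gfp, levelHom N (φ b γ) = levelHom N γ) : (T.ZN N B).Normal := by
  haveI := dZ_normal N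
  refine Semidirect.twistedProd_normal (T.act_mem_dZ N) ?_
  intro b hb γ
  exact mul_inv_map_mem_dZ (φ b).toMonoidHom (T.hdeg b) (hB hb) γ

/-- `Π^tp_{Y_N}` is open. [cite: MochizukiEtTh2009, §1 p.13] -/
theorem isOpen_YN (T : GfpTwistData₀ φ) [TopologicalSpace G] [TopologicalSpace (Gfp ⋊[φ] G)]
    (hc : Continuous fun g : Gfp ⋊[φ] G => (g.left, g.right)) (N : ℕ+) {B : Subgroup G} (hB : IsOpen (B : Set G)) :
    IsOpen (T.YN N B : Set (Gfp ⋊[φ] G)) :=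
  Semidirect.isOpen_twistedProd hc (isOpen_dY N) hB

/-- `Π^tp_{Z_N}` is open. [cite: MochizukiEtTh2009, §1 p.14] -/
theorem isOpen_ZN (T : GfpTwistData₀ φ) [TopologicalSpace G] [TopologicalSpace (Gfp ⋊[φ] G)]
    (hc : Continuous fun g : Gfp ⋊[φ] G => (g.left, g.right)) (N : ℕ+) {B : Subgroup G} (hB : IsOpen (B : Set G)) :
    IsOpen (T.ZN N B : Set (Gfp ⋊[φ] G)) :=
  Semidirect.isOpen_twistedProd hc (isOpen_dZ N) hB

/-- `Π^tp_{Y_N} ∩ Δ^tp_X = Δ^tp_{Y_N} ⋊ 1`. [cite: MochizukiEtTh2009, §1 p.13] -/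
theorem YN_inf_ker_rightHom (T : GfpTwistData₀ φ) (N : ℕ+) (B : Subgroup G) :
    T.YN N B ⊓ (SemidirectProduct.rightHom : Gfp ⋊[φ] G →* G).ker =
      Semidirect.twistedProd (dY N) ⊥ (Semidirect.stable_bot (dY N)) :=
  Semidirect.twistedProd_inf_ker_rightHom

/-- `Π^tp_{Z_N} ∩ Δ^tp_X = Δ^tp_{Z_N} ⋊ 1`. [cite: MochizukiEtTh2009, §1 p.14] -/
theorem ZN_inf_ker_rightHom (T : GfpTwistData₀ φ) (N : ℕ+) (B : Subgroup G) :
    T.ZN N B ⊓ (SemidirectProduct.rightHom : Gfp ⋊[φ] G →* G).ker =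
      Semidirect.twistedProd (dZ N) ⊥ (Semidirect.stable_bot (dZ N)) :=
  Semidirect.twistedProd_inf_ker_rightHom

/-- `Ker(Π^tp_X ↠ Z) ∩ Δ^tp_X = Ker pr₂ ⋊ 1`. [cite: MochizukiEtTh2009, §1 p.12] -/
theorem ker_toZ_inf_ker_rightHom (T : GfpTwistData₀ φ) :
    T.toZ.ker ⊓ (SemidirectProduct.rightHom : Gfp ⋊[φ] G →* G).ker =
      Semidirect.twistedProd gfpSnd.ker ⊥ (Semidirect.stable_bot gfpSnd.ker) := by
  rw [ker_toZ]
  exact Semidirect.twistedProd_inf_ker_rightHom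

/-- **`[Δ^tp_Y : Δ^tp_{Y_N}] = N`**. [cite: MochizukiEtTh2009, §1 p.13] -/
theorem relIndex_YN (T : GfpTwistData₀ φ) (N : ℕ+) (B : Subgroup G) :
    (T.YN N B ⊓ (SemidirectProduct.rightHom : Gfp ⋊[φ] G →* G).ker).relIndex
      (T.toZ.ker ⊓ (SemidirectProduct.rightHom : Gfp ⋊[φ] G →* G).ker) = N := by
  rw [YN_inf_ker_rightHom, ker_toZ_inf_ker_rightHom, Semidirect.relIndex_twistedProd_bot φ, relIndex_dY]

/-- **`[Δ^tp_{Y_N} : Δ^tp_{Z_N}] = N`**. [cite: MochizukiEtTh2009, §1 p.14] -/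
theorem relIndex_ZN (T : GfpTwistData₀ φ) (N : ℕ+) (B' B : Subgroup G) :
    (T.ZN N B' ⊓ (SemidirectProduct.rightHom : Gfp ⋊[φ] G →* G).ker).relIndex
      (T.YN N B ⊓ (SemidirectProduct.rightHom : Gfp ⋊[φ] G →* G).ker) = N := by
  rw [ZN_inf_ker_rightHom, YN_inf_ker_rightHom, Semidirect.relIndex_twistedProd_bot φ, relIndex_dZ]

/-- An element of `Π^tp_{Y_N}` dying at level `N` with `G`-component in `B'` lies in `Π^tp_{Z_N}`.
[cite: MochizukiEtTh2009, §1 p.14] -/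
theorem mem_ZN_of_levelHom_eq_one (T : GfpTwistData₀ φ) {N : ℕ+} {B B' : Subgroup G} {g : Gfp ⋊[φ] G}
    (hg : g ∈ T.YN N B) (hlev : levelHom N g.left = 1) (hright : g.right ∈ B') : g ∈ T.ZN N B' :=
  ⟨Subgroup.mem_inf.mpr ⟨(Subgroup.mem_inf.mp hg.1).1, by rw [MonoidHom.mem_ker]; exact hlev⟩, hright⟩

end GfpTwistData₀

end Literature.AnabelianGeometry.EtaleTheta.SettingModel

end
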